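import Mathlib
import Literature.MathematicalPhysics.QuantumFieldTheory.Balaban1983to89.B6Ineq2134OffDiag

/-!
# `Balaban1983to89.B6Ineq2134Diag` — T. Bałaban, *Propagators and renormalization transformations for lattice gauge
theories. II*, Commun. Math. Phys. **96** (1984) 223–250 [Balaban1984PropagatorsII], p. 247: the bound **(2.134)**
`|(K_{□,□′}G_{□′}h_{□′}J)(x)| ≤ O(M⁻¹)e^{−½δ₂d(y,y′)}|J|` for the DIAGONAL pairs □ = □′ — the four lines of the kernel
K_{□,□} of (2.92), p. 239 — DERIVED, as the print says, from (2.133) (BOTH entries: G_□ and ∇G_□), (2.88) and *"the remarks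
after the inequality (2.68)"*, in the block-majorant language of `…B6RandomWalk` / `…B6Prop26Gluing`, with the O(M⁻¹)
EXPLICIT; kernel-checked.  Companion of `…B6Ineq2134OffDiag` (same seat: the pairs □ ≠ □′).

statement-level skeleton of published theorems with citation tags; proofs where landed; nothing here is a claim about the Yang–Mills mass gap

CITATION HEADER (cell `lit-balaban`, HOME `run/shared/lean/pub/lit-balaban/`; unit `lit-balaban-r03` gen 5 = the B6
reader/fold owner; SKELETON row **B6.Eq2.134** (head `typed-existing (PARTIAL proof: OFF-DIAGONAL family)` before this
file); cell gaps GAPS G-B6-11 («(2.134) asserted») and G-B6-17 (its scope item «diagonal family not kernel-certified» is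
superseded by this file); Phase-2 kind «implication» (PHASE2-TARGETS §G.1/G.2(c)); TAKING line HOME/STATUS.md 2026-08-21T06:01:47Z).
Source held: `paper:balaban1984-cmp96-propagators-rt-ii` (journal page = PDF page + 222); pp. 239 [PDF 17], 247 [PDF 25],
238 [PDF 16] read from the ×2 renders `run/shared/lean/pub/pub-balaban/b2b-balaban-ref1/pages/1984-cmp96-propagators-rt-II/
…-p0NN-x2.png` and from the tree transcription of (2.92) in `…B6Eq291Generator` (p02, p. 239 re-read as an image there).
IMPORTED, NOT MODIFIED: `…B6RandomWalk` (`HasMajorant`, `BlockSupp`, `hasMajorant_mul/add/mono`), `…B6Prop26Gluing` (`mulOp`,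
`ind`, `LocalMajorant`, `OutLoc`, `hasMajorant_finsetSum`, and the CONSUMER `majorant_R_of_2134` whose hypothesis `h2134` this
module produces for □ = □′), `…B6Ineq268` (`LevelSep` = (2.60)), `…B6Lemma21Repaired` (`Ineq263With` = (2.63), generic
constant), `…B6Prop27Kernel` (`ratioP_mul_exp_le` = the power trading of *"the remarks after (2.68)"*), `…B6Ineq2134OffDiag`
(own companion: `term_le`, `sum_le`).

WHAT THE PAPER PRINTS.  p. 239 [PDF 17], (2.92), verbatim (transcription of `…B6Eq291Generator`): *"(K_{□,□}A)_μ(x) =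
Σ_{b∈st(x)} (∂h_□)(b)(∂A_μ)(b) − (Δh_□)(x)A_μ(x) + a(L^jη)^{−2}(S_j*(∂h_□)Q_jA)_μ(x) − a(L^jη)^{−2}(Q_j*S_j(∂h_□)A)_μ(x)
+ (ζ_□(∂P∂* − ∂P_□∂*)h_□A)_μ(x) + (ζ_□P_{□,1}(∂h_□)A)_μ(x) (2.92) if x ∈ B^j(Λ_j) (we replace the index j above by j+1 if
x ∈ B^{j+1}(Λ_{j+1})) … The operators S_j, P_{□,1}(∂h_□) = [∂P_□∂*, h_□] were defined in (1.120). The function ζ_□ is of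
the same type as h_□, but it is equal to 1 on a cube containing □ and with a boundary having the distance 1/3 M to the
boundary of □, and it is equal to 0 outside a similar cube with 1/3 M replaced by 2/3 M."*; by [4] (1.120) (tree:
`…B5Averaging120.gram_mulOp`) line 2 is the kernel commutator `a(L^jη)^{−2}(h_□Q_j*Q_j − Q_j*Q_jh_□)`.  p. 247 [PDF 25],
verbatim: *"|(G_□J)(x)|, |(∇G_□J)(x)| ≤ O(1)[(L^jη)², L^jη]e^{−δ₂(L^jη)^{−1}dist(Δ,Δ′)}|J|, (2.133) for x ∈ Δ(y), supp J ⊂ Δ(y′),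
y, y′ ∈ 𝔅∩T_□. Applying the inequalities (2.133), (2.88) and the remarks after the inequality (2.68) we obtain
|(K_{□,□′}G_{□′}h_{□′}J)(x)| ≤ O(M^{−1})e^{−½δ₂d(y,y′)}|J| (2.134) for x ∈ Δ(y), supp J ⊂ Δ(y′)"*.  p. 238 [PDF 16] (said of
the analogous R of Prop. 2.3, and inherited by *"Reasoning in the same way as in the proof of Proposition 2.2"*, p. 247):
*"the operator with G′(□̃)² − G′² is small and an estimate has the factor e^{−δ₀M} because of the usual estimate of the type
(1.12) [3] connected with a change of a domain. … An estimate of the terms with the commutator is even simpler and gives a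
factor O(M⁻¹)."*  p. 229 [PDF 7]: *"We construct also the corresponding family of functions h described in (1.118), and
rescale them to proper scales."*

THE TYPING (as in the companion).  Fine lattice `X`, block map `blk : X → 𝔅 = g.Site` (`g : B6.Geometry`: `len y = L^jη`,
`dist` = d(y,y′) of (2.46), L, R, M).  `Gl` = G_□ transported to X — an operator ON T_□ (p. 239 *"Both operators are defined
on the torus T_□"*): output-localised to the reach `S` (`hGout : OutLoc`) — with the (2.133)-SHAPE LOCAL majorants
`CG·(L^jη)²·e^{−δ₂d}` (`hG`, the entry |G_□J|) and, for the first-order pieces `E_i ∘ G_□` of line 1 ((∂·)(b)∘G_□, b ∈ st(x)),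
`C₁·(L^jη)·e^{−δ₂d}` (`hEG`, the entry |∇G_□J|); `hI` = h_□ (|h_□| ≤ 1 by (2.36), supported over `S`, and BLOCK-LIPSCHITZ at
scale M: `|h_□(x′) − h_□(x)| ≤ (s/M)(d(y,y′) + r₀)` — the rescaled (1.118)-datum ∇h_□ = O(M⁻¹), `hLip`); line 1 of (2.92) in
its PRINTED first-order form `Σ_i c_i·E_i − c₀` with `|c_i| = |(∂h_□)(b)| ≤ s₁/(M·L^jη)`, `|c₀| = |Δh_□| ≤ s₂/(M·(L^jη)²)`,
supported over `S` (`hc`, `hc₀`); lines 2 and 4 as kernel commutators `z_k·(N_kh_□ − h_□N_k)` with cut-offs `|z_k| ≤ 1`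
(z = −1, resp. ζ_□) and `N_k` (a(L^jη)^{−2}Q_j*Q_j, resp. ∂P_□∂*) of (2.88)-SHAPE majorant `CN·(L^jη)^{−2}·e^{−δ₂d}` (`hN`);
line 3 (the change of domain ζ_□(∂P∂* − ∂P_□∂*)h_□) as ONE operator `D₃` with the displayed *"factor e^{−δ₀M} … change of a
domain"* majorant `CD·e^{−cD·M}·(L^jη)^{−2}·e^{−δ₂d}` (`hD`; the shape of the hypothesis `hdom` of
`…B6Prop27Kernel.inverse_assembled_pow`).

WHAT IS PROVED (0 `sorry`, 0 definitions, 0 named facts; axioms = the standard three; every constant explicit).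
§1 carrier lemmas: `hasMajorant_sandwichW` (left factor bounded by a block weight α(y), right factor |h| ≤ 1, local
   majorant in between), `hasMajorant_of_local` (an operator ON T_□ with a local majorant, times h_□), `hasMajorant_comm`
   (for `N` with majorant `K_N` and a block-Lipschitz `h`, `Nh − hN` has the majorant `lip(y,y′)·K_N(y,y′)`: apply N to
   `(h − h(x))μ`).
§2 scalars: `term_comm_le` (one y″-term of a commutator line: the factor `(d + r₀)` is absorbed by `e^{−⅛δ₂d}`
   (`t·e^{−at} ≤ a⁻¹`), the scale ratio `(L^{j″}η/L^jη)²` by the other `e^{−⅛δ₂d}` through (2.60) and `L² ≤ e^{⅛δ₂RM}`).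
§3 **line 1** `line1_hasMajorant`: `(Σ_i c_iE_i − c₀)·G_□h_□` has the majorant `((#D·s₁C₁ + s₂CG)/M)·e^{−δ₂d(y,y′)}` —
   LOCAL, no intermediate sum: `|∂h_□|·|∇G_□J| + |Δh_□|·|G_□J| = O((ML^jη)⁻¹·L^jη + (M(L^jη)²)⁻¹·(L^jη)²) = O(M⁻¹)`, the
   printed mechanism, the lengths cancelling in the kernel.
§4 **lines 2, 4** `commLine_hasMajorant`: `z·(Nh_□ − h_□N)·G_□h_□` has the majorant
   `(s/M)·CN·CG·L²·(8/δ₂ + r₀)·c²·e^{−½δ₂d(y,y′)}` (§1 commutator + power trading + (2.63) at rate ¾δ₂, α = ⅓).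
§5 **line 3** `domLine_hasMajorant`: `D₃·G_□h_□` has the majorant `CD·e^{−cD·M}·CG·L²·c²·e^{−½δ₂d(y,y′)}` (the companion's
   `term_le` with no gap + (2.63)); `exp_le_inv_mul`: `e^{−cD·M} ≤ (cD·M)⁻¹`.
§6 **(2.134) for □ = □′** `diag_hasMajorant`: the sum of the three families times G_□h_□ has the majorant
   `θ_diag·e^{−½δ₂d(y,y′)}`, `θ_diag = (#D·s₁C₁ + s₂CG)/M + #K·(s/M)·CN·CG·L²·(8/δ₂ + r₀)·c² + CD·e^{−cD·M}·CG·L²·c²`;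
   `theta_diag_le`: `θ_diag ≤ Θ·M⁻¹`, `Θ = #D·s₁C₁ + s₂CG + #K·s·CN·CG·L²·(8/δ₂ + r₀)·c² + CD·CG·L²·c²/cD` — the printed
   O(M⁻¹); `diag_h2134`: the hypothesis shape `HasMajorant blk (Kt * mulOp h_□) K` of `B6Prop26Gluing.majorant_R_of_2134`
   for the pair (□, □) — with the companion's `offDiag_h2134` the consumer's whole `h2134`, pair by pair.
HONEST SCOPE.  (2.133) (Prop. 2.5: both sup entries, in local-majorant form), the (2.88)/(2.6)-shape majorants of ∂P_□∂*
and a(L^jη)^{−2}Q_j*Q_j, the gradient/Lipschitz data of h_□ ((1.118) of [4] rescaled, p. 229) and the change-of-domain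
majorant of line 3 (p. 238) are the displayed HYPOTHESES, exactly as listed — located in print, not re-derived; the identity
«line 1 of (2.92) = [Δ^η + …, h_□] in first-order form» is the print's own display (2.92) (its one-scale lattice form is row
B6.Eq2.39 `…B6Eq239Commutator`, [4] (1.121) is `…B5Averaging120.K121_eq`) and is taken as the definition of line 1; the
overlap/gluing to (2.135) is `…B6Prop26Gluing.ineq2135_of_2134_291`; the rate bookkeeping (⅛, ¾, ⅓, the absorbed `d + r₀`)
is ours — *"The choice of factors is again arbitrary"* (p. 238); nothing on d = 4 or the continuum; NOT summit progress.
-/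

namespace Literature.MathematicalPhysics.QuantumFieldTheory.Balaban1983to89.B6Ineq2134Diag

open B6RandomWalk B6Prop26Gluing Finset
open B6Ineq268 (mx LevelSep mx_nonneg mx_comm)
open B6Lemma21Repaired (Ineq263With)
open B6Prop27Kernel (ratioP ratioP_mul_exp_le ratioP_nonneg)
open B6Ineq2134OffDiag (term_le sum_le)

variable {g : B6.Geometry} {X : Type}

/-! ## §1 Carrier lemmas: weighted sandwich, operators on T_□, commutators with a block-Lipschitz function -/

section Carrier

/-- The opposite of an operator has the same block majorant. [folklore] -/
private theorem hasMajorant_neg' (blk : X → g.Site) {T : Module.End ℝ (X → ℝ)} {K : g.Site → g.Site → ℝ}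
    (hT : HasMajorant blk T K) : HasMajorant blk (-T) K := by
  intro y' μ B hμ x
  rw [LinearMap.neg_apply, Pi.neg_apply, abs_neg]
  exact hT y' μ B hμ x

/-- A left multiplication by a function with |z| ≤ 1 preserves a block majorant. [folklore] -/
private theorem hasMajorant_mulOp_left (blk : X → g.Site) {T : Module.End ℝ (X → ℝ)} {K : g.Site → g.Site → ℝ}
    (hT : HasMajorant blk T K) {z : X → ℝ} (hz : ∀ x, |z x| ≤ 1) : HasMajorant blk (mulOp z * T) K := by
  intro y' μ B hμ x
  rw [Module.End.mul_apply, mulOp_apply, abs_mul]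
  calc |z x| * |T μ x| ≤ 1 * |T μ x| := mul_le_mul_of_nonneg_right (hz x) (abs_nonneg _)
    _ = |T μ x| := one_mul _
    _ ≤ K (blk x) y' * B := hT y' μ B hμ x

/-- **Weighted sandwich** `a·T·h` (the shape of every term of line 1 of (2.92): a = (∂h_□)(b) or Δh_□, T = (∂·)(b)∘G_□ or
G_□, h = h_□): a LOCAL majorant K ≥ 0 of T on the reach S, a left factor with |a(x)| ≤ α(y) (x ∈ B(y)) supported over S and
a right factor |h| ≤ 1 supported over S give the GLOBAL majorant `1_S(y)1_S(y′)·α(y)K(y,y′)`.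
[cite: Balaban1984PropagatorsII, (2.92) p.239 + (2.133) p.247] -/
theorem hasMajorant_sandwichW (blk : X → g.Site) {T : Module.End ℝ (X → ℝ)} {a h : X → ℝ} {S : Set g.Site}
    {K : g.Site → g.Site → ℝ} {α : g.Site → ℝ} (hK : ∀ y y', 0 ≤ K y y') (hα : ∀ y, 0 ≤ α y)
    (haS : ∀ x, a x ≠ 0 → blk x ∈ S) (ha : ∀ x, |a x| ≤ α (blk x)) (hsupp : ∀ x, h x ≠ 0 → blk x ∈ S)
    (hle : ∀ x, |h x| ≤ 1) (hT : LocalMajorant blk T S K) :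
    HasMajorant blk (mulOp a * T * mulOp h) (fun y y' => ind S y * ind S y' * (α y * K y y')) := by
  intro y' μ B hμ x
  beta_reduce
  have hnn : 0 ≤ ind S (blk x) * ind S y' * (α (blk x) * K (blk x) y') * B :=
    mul_nonneg (mul_nonneg (mul_nonneg (ind_nonneg _ _) (ind_nonneg _ _)) (mul_nonneg (hα _) (hK _ _))) hμ.nonneg
  rw [Module.End.mul_apply, Module.End.mul_apply, mulOp_apply]
  by_cases hx : a x = 0
  · rw [hx, zero_mul, abs_zero]
    exact hnn
  have hxS : blk x ∈ S := haS x hx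
  by_cases hy : y' ∈ S
  · rw [ind_of_mem hxS, ind_of_mem hy, one_mul, one_mul, abs_mul]
    calc |a x| * |T (mulOp h μ) x| ≤ α (blk x) * (K (blk x) y' * B) :=
          mul_le_mul (ha x) (hT y' hy (mulOp h μ) B (blockSupp_mulOp blk hle hμ) x hxS) (abs_nonneg _) (hα _)
      _ = α (blk x) * K (blk x) y' * B := by ring
  · rw [mulOp_eq_zero_of_blockSupp blk hsupp hμ hy, map_zero, Pi.zero_apply, mul_zero, abs_zero]
    exact hnn

/-- **An operator ON T_□ times h_□** (p. 239: *"Both operators are defined on the torus T_□"*): a LOCAL majorant K ≥ 0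
of T on the reach S, OUTPUT localisation of T to S (T maps into functions on T_□, transported by zero) and a right factor
|h| ≤ 1 supported over S give the global majorant `1_S(y)1_S(y′)K(y,y′)` of `T·h`.
[cite: Balaban1984PropagatorsII, (2.90)–(2.91) p.239] -/
theorem hasMajorant_of_local (blk : X → g.Site) {T : Module.End ℝ (X → ℝ)} {h : X → ℝ} {S : Set g.Site}
    {K : g.Site → g.Site → ℝ} (hK : ∀ y y', 0 ≤ K y y') (hout : OutLoc blk T S)
    (hsupp : ∀ x, h x ≠ 0 → blk x ∈ S) (hle : ∀ x, |h x| ≤ 1) (hT : LocalMajorant blk T S K) :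
    HasMajorant blk (T * mulOp h) (fun y y' => ind S y * ind S y' * K y y') := by
  intro y' μ B hμ x
  beta_reduce
  have hnn : 0 ≤ ind S (blk x) * ind S y' * K (blk x) y' * B :=
    mul_nonneg (mul_nonneg (mul_nonneg (ind_nonneg _ _) (ind_nonneg _ _)) (hK _ _)) hμ.nonneg
  rw [Module.End.mul_apply]
  by_cases hxS : blk x ∈ S
  · by_cases hy : y' ∈ S
    · rw [ind_of_mem hxS, ind_of_mem hy, one_mul, one_mul]
      exact hT y' hy (mulOp h μ) B (blockSupp_mulOp blk hle hμ) x hxS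
    · rw [mulOp_eq_zero_of_blockSupp blk hsupp hμ hy, map_zero, Pi.zero_apply, abs_zero]
      exact hnn
  · rw [hout _ x hxS, abs_zero]
    exact hnn

/-- **The commutator with a block-Lipschitz function** (the mechanism of lines 2 and 4 of (2.92), *"P_{□,1}(∂h_□) =
[∂P_□∂*, h_□]"*, and of [4] (1.120): the entries of `Nh − hN` are `N(x,x′)(h(x′) − h(x))`): if `N` has the majorant `K_N`
and `|h(x′) − h(x)| ≤ lip(y,y′)` for x ∈ B(y), x′ ∈ B(y′), with lip ≥ 0, then `Nh − hN` has the majorant `lip(y,y′)·K_N(y,y′)`.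
[cite: Balaban1984PropagatorsII, (2.92) p.239] -/
theorem hasMajorant_comm (blk : X → g.Site) {N : Module.End ℝ (X → ℝ)} {KN : g.Site → g.Site → ℝ}
    (hN : HasMajorant blk N KN) {h : X → ℝ} {lip : g.Site → g.Site → ℝ} (hlip : ∀ y y', 0 ≤ lip y y')
    (hLip : ∀ x x', |h x' - h x| ≤ lip (blk x) (blk x')) :
    HasMajorant blk (N * mulOp h - mulOp h * N) (fun y y' => lip y y' * KN y y') := by
  intro y' μ B hμ x
  beta_reduce
  -- the function (h − h(x))μ, supported in the block of y′ with bound lip(y,y′)·B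
  set ν : X → ℝ := fun x' => (h x' - h x) * μ x' with hν
  have hνsupp : BlockSupp blk ν y' (lip (blk x) y' * B) := by
    refine ⟨mul_nonneg (hlip _ _) hμ.nonneg, fun x' hx' => ?_, fun x' hx' => ?_⟩
    · rw [hν]
      dsimp only
      rw [abs_mul]
      have h1 : |h x' - h x| ≤ lip (blk x) y' := by rw [← hx']; exact hLip x x'
      exact mul_le_mul h1 (hμ.bound x' hx') (abs_nonneg _) (hlip _ _)
    · rw [hν]
      dsimp only
      rw [hμ.off x' hx', mul_zero]
  have hνeq : ν = mulOp h μ - h x • μ := by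
    funext x'
    simp only [hν, Pi.sub_apply, mulOp_apply, Pi.smul_apply, smul_eq_mul]
    ring
  have hid : (N * mulOp h - mulOp h * N) μ x = N ν x := by
    rw [hνeq, map_sub, map_smul, LinearMap.sub_apply, Module.End.mul_apply, Module.End.mul_apply, Pi.sub_apply,
      mulOp_apply, Pi.sub_apply, Pi.smul_apply, smul_eq_mul]
  rw [hid]
  calc |N ν x| ≤ KN (blk x) y' * (lip (blk x) y' * B) := hN y' ν _ hνsupp x
    _ = lip (blk x) y' * KN (blk x) y' * B := by ring

end Carrier

/-! ## §2 Scalars: `t·e^{−at} ≤ a⁻¹` and the commutator term -/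

section Scalar

/-- `t·e^{−at} ≤ a⁻¹` for `a > 0` (from `1 + at ≤ e^{at}`). [folklore] -/
private theorem mul_exp_le {a : ℝ} (ha : 0 < a) (t : ℝ) : t * Real.exp (-(a * t)) ≤ a⁻¹ := by
  have h1 : a * t ≤ Real.exp (a * t) := by linarith [Real.add_one_le_exp (a * t)]
  have h2 : a * t * Real.exp (-(a * t)) ≤ 1 := by
    rw [Real.exp_neg, ← div_eq_mul_inv, div_le_one (Real.exp_pos _)]
    exact h1
  calc t * Real.exp (-(a * t)) = a⁻¹ * (a * t * Real.exp (-(a * t))) := by field_simp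
    _ ≤ a⁻¹ * 1 := mul_le_mul_of_nonneg_left h2 (inv_nonneg.mpr ha.le)
    _ = a⁻¹ := mul_one _

/-- `(t + r₀)·e^{−at} ≤ a⁻¹ + r₀` for `a > 0`, `t, r₀ ≥ 0`. [folklore] -/
private theorem add_mul_exp_le {a t r₀ : ℝ} (ha : 0 < a) (ht : 0 ≤ t) (hr₀ : 0 ≤ r₀) :
    (t + r₀) * Real.exp (-(a * t)) ≤ a⁻¹ + r₀ := by
  have h1 := mul_exp_le ha t
  have h2 : r₀ * Real.exp (-(a * t)) ≤ r₀ := by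
    have : Real.exp (-(a * t)) ≤ 1 := Real.exp_le_one_iff.mpr (by nlinarith)
    exact (mul_le_mul_of_nonneg_left this hr₀).trans_eq (mul_one _)
  calc (t + r₀) * Real.exp (-(a * t)) = t * Real.exp (-(a * t)) + r₀ * Real.exp (-(a * t)) := by ring
    _ ≤ a⁻¹ + r₀ := add_le_add h1 h2

/-- `e^{−δt} = e^{−⅛δt}·e^{−⅛δt}·e^{−¾δt}`. [folklore] -/
private theorem exp_split (δ t : ℝ) :
    Real.exp (-(δ * t)) =
      Real.exp (-(1 / 8 * δ * t)) * Real.exp (-(1 / 8 * δ * t)) * Real.exp (-(3 / 4 * δ * t)) := by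
  rw [← Real.exp_add, ← Real.exp_add]
  congr 1
  ring

/-- `(L^{j″}η)²/(L^jη)² = L^{2j″}/L^{2j}` = the scale weight `ratioP g 2 y″ y`. [cite: Balaban1984PropagatorsII, (2.68) p.235] -/
private theorem len_sq_ratio (hL : 0 < g.L) (hη : 0 < g.eta) (y y'' : g.Site) :
    g.len y'' ^ 2 / g.len y ^ 2 = ratioP g 2 y'' y := by
  unfold B6.Geometry.len ratioP
  have hLy : g.L ^ g.scale y ≠ 0 := pow_ne_zero _ hL.ne'
  have hLy'' : g.L ^ g.scale y'' ≠ 0 := pow_ne_zero _ hL.ne'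
  rw [mul_pow, mul_pow, ← pow_mul, ← pow_mul, mul_comm (g.scale y'') 2, mul_comm (g.scale y) 2]
  field_simp

/-- The symmetric reading of `mx`: `mx g y″ y = mx g y y″`. [folklore] -/
private theorem mx_symm (y y'' : g.Site) : mx g y'' y = mx g y y'' := by
  rw [mx_comm y y'']
  rfl

/-- **ONE y″-TERM OF A COMMUTATOR LINE** (lines 2, 4 of (2.92) in (2.134)): the Lipschitz factor `(s/M)(d(y,y″) + r₀)` times
the (2.88)-shape entry `CN(L^jη)^{−2}e^{−δ₂d(y,y″)}` times the (2.133)-shape entry `CG(L^{j″}η)²e^{−δ₂d(y″,y′)}` is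
`≤ (s/M)·CN·CG·L²·(8/δ₂ + r₀)·e^{−¾δ₂d(y,y″)}e^{−¾δ₂d(y″,y′)}`: `(d + r₀)` is absorbed by one factor `e^{−⅛δ₂d(y,y″)}`, the
scale ratio by the other through (2.60) and `L² ≤ e^{⅛δ₂RM}` (*"the remarks after (2.68)"*).
[cite: Balaban1984PropagatorsII, (2.134) p.247] -/
theorem term_comm_le (hL : 1 ≤ g.L) (hη : 0 < g.eta) (hsep : LevelSep g) (hd : ∀ a b, 0 ≤ g.dist a b)
    {δ₂ CN CG s r₀ : ℝ} (hδ₂ : 0 < δ₂) (hCN : 0 ≤ CN) (hCG : 0 ≤ CG) (hs : 0 ≤ s) (hr₀ : 0 ≤ r₀) (hM : 0 < g.M)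
    (hRM : 0 ≤ g.R * g.M) (hthr : g.L ^ 2 ≤ Real.exp (1 / 8 * δ₂ * (g.R * g.M))) (y y'' y' : g.Site) :
    s / g.M * (g.dist y y'' + r₀) * (CN / g.len y ^ 2 * Real.exp (-(δ₂ * g.dist y y''))) *
        (CG * g.len y'' ^ 2 * Real.exp (-(δ₂ * g.dist y'' y'))) ≤
      s / g.M * (CN * CG * g.L ^ 2 * (8 / δ₂ + r₀)) *
        (Real.exp (-(3 / 4 * δ₂ * g.dist y y'')) * Real.exp (-(3 / 4 * δ₂ * g.dist y'' y'))) := by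
  have hL0 : 0 < g.L := zero_lt_one.trans_le hL
  have hlen : ∀ z : g.Site, 0 < g.len z := fun z => mul_pos (pow_pos hL0 _) hη
  -- the scale weight and its absorption: ratio·e^{−⅛δ₂d(y,y″)} ≤ L²
  have hβ : 0 ≤ 1 / 8 * δ₂ * (g.R * g.M) := by positivity
  have habs : ratioP g 2 y'' y * Real.exp (-(1 / 8 * δ₂ * g.dist y y'')) ≤ g.L ^ 2 := by
    have h1 := ratioP_mul_exp_le (g := g) hL hβ 2 hthr y'' y
    have hmx : g.R * g.M * mx g y'' y ≤ g.dist y y'' := by rw [mx_symm]; exact hsep y y''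
    have h2 : Real.exp (-(1 / 8 * δ₂ * g.dist y y'')) ≤ Real.exp (-(1 / 8 * δ₂ * (g.R * g.M) * mx g y'' y)) := by
      apply Real.exp_le_exp.mpr
      have : 1 / 8 * δ₂ * (g.R * g.M * mx g y'' y) ≤ 1 / 8 * δ₂ * g.dist y y'' :=
        mul_le_mul_of_nonneg_left hmx (by positivity)
      nlinarith
    exact (mul_le_mul_of_nonneg_left h2 (ratioP_nonneg hL0.le 2 y'' y)).trans h1
  -- the Lipschitz factor absorbed by the second e^{−⅛δ₂d(y,y″)}
  have hlipE : (g.dist y y'' + r₀) * Real.exp (-(1 / 8 * δ₂ * g.dist y y'')) ≤ 8 / δ₂ + r₀ := by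
    have h := add_mul_exp_le (a := 1 / 8 * δ₂) (by positivity) (hd y y'') hr₀
    have e8 : (1 / 8 * δ₂)⁻¹ = 8 / δ₂ := by
      rw [one_div, mul_inv, inv_inv]
      field_simp
    rw [e8] at h
    exact h
  -- the last factor loses ¼ of its rate
  have hlast : Real.exp (-(δ₂ * g.dist y'' y')) ≤ Real.exp (-(3 / 4 * δ₂ * g.dist y'' y')) := by
    apply Real.exp_le_exp.mpr
    have := hd y'' y'
    nlinarith
  -- assemble
  have hratio : CN / g.len y ^ 2 * (CG * g.len y'' ^ 2) = CN * CG * ratioP g 2 y'' y := by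
    rw [← len_sq_ratio hL0 hη y y'']
    field_simp
  have hsM : 0 ≤ s / g.M := div_nonneg hs hM.le
  calc s / g.M * (g.dist y y'' + r₀) * (CN / g.len y ^ 2 * Real.exp (-(δ₂ * g.dist y y''))) *
        (CG * g.len y'' ^ 2 * Real.exp (-(δ₂ * g.dist y'' y')))
      = s / g.M * (g.dist y y'' + r₀) * (CN / g.len y ^ 2 * (CG * g.len y'' ^ 2)) *
          Real.exp (-(δ₂ * g.dist y y'')) * Real.exp (-(δ₂ * g.dist y'' y')) := by ring
    _ = s / g.M * (CN * CG) * (ratioP g 2 y'' y * Real.exp (-(1 / 8 * δ₂ * g.dist y y''))) *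
          ((g.dist y y'' + r₀) * Real.exp (-(1 / 8 * δ₂ * g.dist y y''))) *
          Real.exp (-(3 / 4 * δ₂ * g.dist y y'')) * Real.exp (-(δ₂ * g.dist y'' y')) := by
        rw [hratio, exp_split δ₂ (g.dist y y'')]
        ring
    _ ≤ s / g.M * (CN * CG) * g.L ^ 2 * (8 / δ₂ + r₀) * Real.exp (-(3 / 4 * δ₂ * g.dist y y'')) *
          Real.exp (-(3 / 4 * δ₂ * g.dist y'' y')) := by
        have hCC : 0 ≤ s / g.M * (CN * CG) := mul_nonneg hsM (mul_nonneg hCN hCG)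
        have hlipnn : 0 ≤ (g.dist y y'' + r₀) * Real.exp (-(1 / 8 * δ₂ * g.dist y y'')) :=
          mul_nonneg (add_nonneg (hd y y'') hr₀) (Real.exp_nonneg _)
        gcongr
    _ = _ := by ring

end Scalar

/-! ## §3 Line 1 of (2.92): the first-order form `Σ_b(∂h_□)(b)(∂·)(b) − (Δh_□)(x)` against both entries of (2.133) -/

section LineOne

/-- **LINE 1 OF (2.92) IN (2.134)** — `Σ_{b∈st(x)}(∂h_□)(b)(∂G_□h_□J)(b) − (Δh_□)(x)(G_□h_□J)(x)` — KERNEL-CHECKED in the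
block-majorant language: with the first-order pieces `E_i ∘ G_□` ((∂·)(b)∘G_□, b ∈ st(x)) under the (2.133)-shape local
majorant `C₁·(L^jη)·e^{−δ₂d}` (the entry |∇G_□J|), G_□ under `CG·(L^jη)²·e^{−δ₂d}` (the entry |G_□J|), coefficients
`|c_i| ≤ s₁/(M·L^jη)` (= |∂h_□|) and `|c₀| ≤ s₂/(M·(L^jη)²)` (= |Δh_□|) supported over the reach S, and |h_□| ≤ 1 supported
over S, the operator `(Σ_i c_iE_i − c₀)·G_□·h_□` has the majorant `((#D·s₁C₁ + s₂CG)/M)·e^{−δ₂d(y,y′)}`: the scale factors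
cancel exactly as in print, `(M·L^jη)⁻¹·L^jη + (M(L^jη)²)⁻¹·(L^jη)² = O(M⁻¹)`; no intermediate sum.
[cite: Balaban1984PropagatorsII, (2.134) p.247 + (2.92) p.239] -/
theorem line1_hasMajorant (blk : X → g.Site) (hL : 0 < g.L) (hη : 0 < g.eta) (hM : 0 < g.M)
    {δ₂ CG C₁ s₁ s₂ : ℝ} (hCG : 0 ≤ CG) (hC₁ : 0 ≤ C₁) (hs₁ : 0 ≤ s₁) (hs₂ : 0 ≤ s₂)
    {ι : Type} (D : Finset ι) {E : ι → Module.End ℝ (X → ℝ)} {c : ι → X → ℝ} {c₀ hI : X → ℝ}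
    {Gl : Module.End ℝ (X → ℝ)} {S : Set g.Site}
    (hG : LocalMajorant blk Gl S fun y y' => CG * g.len y ^ 2 * Real.exp (-(δ₂ * g.dist y y')))
    (hEG : ∀ i ∈ D, LocalMajorant blk (E i * Gl) S fun y y' => C₁ * g.len y * Real.exp (-(δ₂ * g.dist y y')))
    (hc : ∀ i ∈ D, ∀ x, |c i x| ≤ s₁ / (g.M * g.len (blk x))) (hcS : ∀ i ∈ D, ∀ x, c i x ≠ 0 → blk x ∈ S)
    (hc₀ : ∀ x, |c₀ x| ≤ s₂ / (g.M * g.len (blk x) ^ 2)) (hc₀S : ∀ x, c₀ x ≠ 0 → blk x ∈ S)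
    (hI1 : ∀ x, |hI x| ≤ 1) (hIS : ∀ x, hI x ≠ 0 → blk x ∈ S) :
    HasMajorant blk ((∑ i ∈ D, mulOp (c i) * E i - mulOp c₀) * (Gl * mulOp hI)) fun y y' =>
      (D.card * (s₁ * C₁) + s₂ * CG) / g.M * Real.exp (-(δ₂ * g.dist y y')) := by
  classical
  have hlen : ∀ z : g.Site, 0 < g.len z := fun z => mul_pos (pow_pos hL _) hη
  -- distribute the right factor G_□h_□ over the first-order sum
  have e : (∑ i ∈ D, mulOp (c i) * E i - mulOp c₀) * (Gl * mulOp hI) =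
      ∑ i ∈ D, mulOp (c i) * (E i * Gl) * mulOp hI + -(mulOp c₀ * Gl * mulOp hI) := by
    rw [sub_mul, Finset.sum_mul]
    simp only [mul_assoc, sub_eq_add_neg]
  rw [e]
  -- the first-order terms: |∂h_□|·|∇G_□J|
  have hK₁ : ∀ y y' : g.Site, 0 ≤ C₁ * g.len y * Real.exp (-(δ₂ * g.dist y y')) := fun y y' => by
    have := hlen y
    positivity
  have hα₁ : ∀ y : g.Site, 0 ≤ s₁ / (g.M * g.len y) := fun y => by
    have := hlen y
    positivity
  have hterm : ∀ i ∈ D, HasMajorant blk (mulOp (c i) * (E i * Gl) * mulOp hI) fun y y' =>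
      ind S y * ind S y' * (s₁ / (g.M * g.len y) * (C₁ * g.len y * Real.exp (-(δ₂ * g.dist y y')))) :=
    fun i hi => hasMajorant_sandwichW blk hK₁ hα₁ (hcS i hi) (hc i hi) hIS hI1 (hEG i hi)
  have hsum := hasMajorant_finsetSum blk D _ _ hterm
  -- the zeroth-order term: |Δh_□|·|G_□J|
  have hK₀ : ∀ y y' : g.Site, 0 ≤ CG * g.len y ^ 2 * Real.exp (-(δ₂ * g.dist y y')) := fun y y' => by positivity
  have hα₀ : ∀ y : g.Site, 0 ≤ s₂ / (g.M * g.len y ^ 2) := fun y => by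
    have := hlen y
    positivity
  have h0 : HasMajorant blk (mulOp c₀ * Gl * mulOp hI) fun y y' =>
      ind S y * ind S y' * (s₂ / (g.M * g.len y ^ 2) * (CG * g.len y ^ 2 * Real.exp (-(δ₂ * g.dist y y')))) :=
    hasMajorant_sandwichW blk hK₀ hα₀ hc₀S hc₀ hIS hI1 hG
  have hall := hasMajorant_add blk hsum (hasMajorant_neg' blk h0)
  refine hasMajorant_mono blk hall fun y y' => ?_
  -- pointwise: the lengths cancel
  have hy : g.len y ≠ 0 := (hlen y).ne'
  have hMne : g.M ≠ 0 := hM.ne'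
  have hii : ind S y * ind S y' ≤ 1 :=
    (mul_le_mul (ind_le_one _ _) (ind_le_one _ _) (ind_nonneg _ _) zero_le_one).trans_eq (one_mul 1)
  have hii0 : 0 ≤ ind S y * ind S y' := mul_nonneg (ind_nonneg _ _) (ind_nonneg _ _)
  have e1 : s₁ / (g.M * g.len y) * (C₁ * g.len y * Real.exp (-(δ₂ * g.dist y y'))) =
      s₁ * C₁ / g.M * Real.exp (-(δ₂ * g.dist y y')) := by
    field_simp
  have e2 : s₂ / (g.M * g.len y ^ 2) * (CG * g.len y ^ 2 * Real.exp (-(δ₂ * g.dist y y'))) =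
      s₂ * CG / g.M * Real.exp (-(δ₂ * g.dist y y')) := by
    field_simp
  have hE : 0 ≤ Real.exp (-(δ₂ * g.dist y y')) := Real.exp_nonneg _
  have h1 : ∀ i ∈ D, ind S y * ind S y' * (s₁ / (g.M * g.len y) * (C₁ * g.len y * Real.exp (-(δ₂ * g.dist y y')))) ≤
      s₁ * C₁ / g.M * Real.exp (-(δ₂ * g.dist y y')) := by
    intro i _
    rw [e1]
    have hnn : 0 ≤ s₁ * C₁ / g.M * Real.exp (-(δ₂ * g.dist y y')) := by positivity
    exact (mul_le_mul_of_nonneg_right hii hnn).trans_eq (one_mul _)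
  have h2 : ind S y * ind S y' * (s₂ / (g.M * g.len y ^ 2) * (CG * g.len y ^ 2 * Real.exp (-(δ₂ * g.dist y y')))) ≤
      s₂ * CG / g.M * Real.exp (-(δ₂ * g.dist y y')) := by
    rw [e2]
    have hnn : 0 ≤ s₂ * CG / g.M * Real.exp (-(δ₂ * g.dist y y')) := by positivity
    exact (mul_le_mul_of_nonneg_right hii hnn).trans_eq (one_mul _)
  calc ∑ i ∈ D, ind S y * ind S y' * (s₁ / (g.M * g.len y) * (C₁ * g.len y * Real.exp (-(δ₂ * g.dist y y')))) +
        ind S y * ind S y' * (s₂ / (g.M * g.len y ^ 2) * (CG * g.len y ^ 2 * Real.exp (-(δ₂ * g.dist y y'))))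
      ≤ ∑ i ∈ D, s₁ * C₁ / g.M * Real.exp (-(δ₂ * g.dist y y')) + s₂ * CG / g.M * Real.exp (-(δ₂ * g.dist y y')) :=
        add_le_add (Finset.sum_le_sum h1) h2
    _ = (D.card * (s₁ * C₁) + s₂ * CG) / g.M * Real.exp (-(δ₂ * g.dist y y')) := by
        rw [Finset.sum_const, nsmul_eq_mul]
        field_simp

end LineOne

/-! ## §4 Lines 2 and 4 of (2.92): the kernel commutators `a(L^jη)⁻²[h_□, Q*Q]`, `ζ_□[∂P_□∂*, h_□]` -/

section CommLines

/-- **A COMMUTATOR LINE OF (2.92) IN (2.134)**, KERNEL-CHECKED: for a kernel operator `N` with the (2.88)-shape majorant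
`CN·(L^jη)^{−2}·e^{−δ₂d(y,y″)}` (∂P_□∂*, resp. a(L^jη)^{−2}Q_j*Q_j), a cut-off |z| ≤ 1 (ζ_□, resp. 1), the block-Lipschitz
datum `|h_□(x′) − h_□(x)| ≤ (s/M)(d(y,y′) + r₀)` of the commutated function, G_□ ON T_□ (output-localised to the reach S) with
the (2.133)-shape local majorant `CG·(L^{j″}η)²·e^{−δ₂d(y″,y′)}`, |h_□| ≤ 1 supported over S, (2.60) with `L² ≤ e^{⅛δ₂RM}`
and (2.63) at rate ¾δ₂, α = ⅓: the operator `z·(Nh_□ − h_□N)·G_□h_□` has the majorant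
`(s/M)·CN·CG·L²·(8/δ₂ + r₀)·c²·e^{−½δ₂d(y,y′)}` — the printed *"factor O(M⁻¹)"* of *"the terms with the commutator"*.
[cite: Balaban1984PropagatorsII, (2.134) p.247 + (2.92) p.239 + p.238] -/
theorem commLine_hasMajorant (blk : X → g.Site) (hL : 1 ≤ g.L) (hη : 0 < g.eta) (hsep : LevelSep g)
    (hd : ∀ a b, 0 ≤ g.dist a b) {δ₂ CN CG c s r₀ : ℝ} (hδ₂ : 0 < δ₂) (hCN : 0 ≤ CN) (hCG : 0 ≤ CG)
    (hs : 0 ≤ s) (hr₀ : 0 ≤ r₀) (hM : 0 < g.M) (hRM : 0 ≤ g.R * g.M)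
    (hthr : g.L ^ 2 ≤ Real.exp (1 / 8 * δ₂ * (g.R * g.M))) (h263 : Ineq263With c g (3 / 4 * δ₂) (1 / 3))
    {N Gl : Module.End ℝ (X → ℝ)} {z hc hI : X → ℝ} {S : Set g.Site}
    (hN : HasMajorant blk N fun y y'' => CN / g.len y ^ 2 * Real.exp (-(δ₂ * g.dist y y'')))
    (hz : ∀ x, |z x| ≤ 1) (hLip : ∀ x x', |hc x' - hc x| ≤ s / g.M * (g.dist (blk x) (blk x') + r₀))
    (hG : LocalMajorant blk Gl S fun y'' y' => CG * g.len y'' ^ 2 * Real.exp (-(δ₂ * g.dist y'' y')))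
    (hGout : OutLoc blk Gl S) (hI1 : ∀ x, |hI x| ≤ 1) (hIS : ∀ x, hI x ≠ 0 → blk x ∈ S) :
    HasMajorant blk (mulOp z * (N * mulOp hc - mulOp hc * N) * (Gl * mulOp hI)) fun y y' =>
      s / g.M * (CN * CG * g.L ^ 2 * (8 / δ₂ + r₀)) * c ^ 2 * Real.exp (-(1 / 2 * δ₂ * g.dist y y')) := by
  classical
  have hL0 : 0 < g.L := zero_lt_one.trans_le hL
  have hlen : ∀ z : g.Site, 0 < g.len z := fun z => mul_pos (pow_pos hL0 _) hη
  -- (1) the commutator with the block-Lipschitz h_□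
  have hlipnn : ∀ y y'' : g.Site, 0 ≤ s / g.M * (g.dist y y'' + r₀) := fun y y'' => by
    have := hd y y''
    positivity
  have hcomm := hasMajorant_comm blk hN (lip := fun y y'' => s / g.M * (g.dist y y'' + r₀)) hlipnn hLip
  -- (2) G_□h_□ as a global operator
  have hKG : ∀ a b : g.Site, 0 ≤ CG * g.len a ^ 2 * Real.exp (-(δ₂ * g.dist a b)) := fun a b => by positivity
  have hGl := hasMajorant_of_local blk hKG hGout hIS hI1 hG
  have hGlnn : ∀ a b : g.Site, 0 ≤ ind S a * ind S b * (CG * g.len a ^ 2 * Real.exp (-(δ₂ * g.dist a b))) :=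
    fun a b => mul_nonneg (mul_nonneg (ind_nonneg _ _) (ind_nonneg _ _)) (hKG a b)
  -- (3) composition and the cut-off
  have hmul := hasMajorant_mul blk hcomm hGl hGlnn
  have hzT := hasMajorant_mulOp_left blk hmul hz
  rw [mul_assoc (mulOp z)]
  refine hasMajorant_mono blk hzT fun y y' => ?_
  -- (4) the pointwise bound
  have hKN : ∀ y'' : g.Site, 0 ≤ CN / g.len y ^ 2 * Real.exp (-(δ₂ * g.dist y y'')) := fun y'' => by
    have := hlen y
    positivity
  have hterm : ∀ y'' : g.Site,
      s / g.M * (g.dist y y'' + r₀) * (CN / g.len y ^ 2 * Real.exp (-(δ₂ * g.dist y y''))) *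
        (ind S y'' * ind S y' * (CG * g.len y'' ^ 2 * Real.exp (-(δ₂ * g.dist y'' y')))) ≤
      s / g.M * (CN * CG * g.L ^ 2 * (8 / δ₂ + r₀)) *
        (Real.exp (-(3 / 4 * δ₂ * g.dist y y'')) * Real.exp (-(3 / 4 * δ₂ * g.dist y'' y'))) := by
    intro y''
    have hii : ind S y'' * ind S y' ≤ 1 :=
      (mul_le_mul (ind_le_one _ _) (ind_le_one _ _) (ind_nonneg _ _) zero_le_one).trans_eq (one_mul 1)
    have ht := term_comm_le hL hη hsep hd hδ₂ hCN hCG hs hr₀ hM hRM hthr y y'' y'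
    have hA : 0 ≤ s / g.M * (g.dist y y'' + r₀) * (CN / g.len y ^ 2 * Real.exp (-(δ₂ * g.dist y y''))) *
        (CG * g.len y'' ^ 2 * Real.exp (-(δ₂ * g.dist y'' y'))) :=
      mul_nonneg (mul_nonneg (hlipnn y y'') (hKN y'')) (hKG y'' y')
    calc s / g.M * (g.dist y y'' + r₀) * (CN / g.len y ^ 2 * Real.exp (-(δ₂ * g.dist y y''))) *
          (ind S y'' * ind S y' * (CG * g.len y'' ^ 2 * Real.exp (-(δ₂ * g.dist y'' y'))))
        = ind S y'' * ind S y' * (s / g.M * (g.dist y y'' + r₀) *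
            (CN / g.len y ^ 2 * Real.exp (-(δ₂ * g.dist y y''))) *
            (CG * g.len y'' ^ 2 * Real.exp (-(δ₂ * g.dist y'' y')))) := by ring
      _ ≤ 1 * (s / g.M * (g.dist y y'' + r₀) * (CN / g.len y ^ 2 * Real.exp (-(δ₂ * g.dist y y''))) *
            (CG * g.len y'' ^ 2 * Real.exp (-(δ₂ * g.dist y'' y')))) := mul_le_mul_of_nonneg_right hii hA
      _ ≤ _ := by rw [one_mul]; exact ht
  have hKnn : 0 ≤ s / g.M * (CN * CG * g.L ^ 2 * (8 / δ₂ + r₀)) := by positivity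
  calc ∑ y'' : g.Site, s / g.M * (g.dist y y'' + r₀) * (CN / g.len y ^ 2 * Real.exp (-(δ₂ * g.dist y y''))) *
          (ind S y'' * ind S y' * (CG * g.len y'' ^ 2 * Real.exp (-(δ₂ * g.dist y'' y'))))
      ≤ ∑ y'' : g.Site, s / g.M * (CN * CG * g.L ^ 2 * (8 / δ₂ + r₀)) *
          (Real.exp (-(3 / 4 * δ₂ * g.dist y y'')) * Real.exp (-(3 / 4 * δ₂ * g.dist y'' y'))) :=
        Finset.sum_le_sum fun y'' _ => hterm y''
    _ = s / g.M * (CN * CG * g.L ^ 2 * (8 / δ₂ + r₀)) *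
          ∑ y'' : g.Site, Real.exp (-(3 / 4 * δ₂ * g.dist y y'')) * Real.exp (-(3 / 4 * δ₂ * g.dist y'' y')) := by
        rw [Finset.mul_sum]
    _ ≤ s / g.M * (CN * CG * g.L ^ 2 * (8 / δ₂ + r₀)) * (c ^ 2 * Real.exp (-(1 / 2 * δ₂ * g.dist y y'))) :=
        mul_le_mul_of_nonneg_left (sum_le h263 y y') hKnn
    _ = _ := by ring

end CommLines

/-! ## §5 Line 3 of (2.92): the change of domain `ζ_□(∂P∂* − ∂P_□∂*)h_□` -/

section DomLine

/-- `e^{−cM} ≤ (cM)⁻¹` for `c, M > 0`: the displayed *"factor e^{−δ₀M}"* is an O(M⁻¹). [folklore] -/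
private theorem exp_le_inv_mul {cD M : ℝ} (hc : 0 < cD) (hM : 0 < M) : Real.exp (-(cD * M)) ≤ (cD * M)⁻¹ := by
  have h := mul_exp_le hc M
  rw [mul_inv]
  calc Real.exp (-(cD * M)) = M⁻¹ * (M * Real.exp (-(cD * M))) := by field_simp
    _ ≤ M⁻¹ * cD⁻¹ := mul_le_mul_of_nonneg_left h (inv_nonneg.mpr hM.le)
    _ = cD⁻¹ * M⁻¹ := mul_comm _ _

/-- **LINE 3 OF (2.92) IN (2.134)**, KERNEL-CHECKED: an operator `D₃` (= ζ_□(∂P∂* − ∂P_□∂*)h_□) with the displayed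
change-of-domain majorant `CD·e^{−cD·M}·(L^jη)^{−2}·e^{−δ₂d(y,y″)}` (p. 238: *"an estimate has the factor e^{−δ₀M} because
of the usual estimate of the type (1.12) [3] connected with a change of a domain"*), composed with G_□h_□ (G_□ ON T_□ with
the (2.133)-shape local majorant, |h_□| ≤ 1 over S), has — by (2.60) with `L² ≤ e^{⅛δ₂RM}` and (2.63) at rate ¾δ₂, α = ⅓ —
the majorant `CD·e^{−cD·M}·CG·L²·c²·e^{−½δ₂d(y,y′)}`. [cite: Balaban1984PropagatorsII, (2.134) p.247 + (2.92) p.239 + p.238] -/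
theorem domLine_hasMajorant (blk : X → g.Site) (hL : 1 ≤ g.L) (hη : 0 < g.eta) (hsep : LevelSep g)
    (hd : ∀ a b, 0 ≤ g.dist a b) {δ₂ CD cD CG c : ℝ} (hδ₂ : 0 ≤ δ₂) (hCD : 0 ≤ CD) (hCG : 0 ≤ CG)
    (hRM : 0 ≤ g.R * g.M) (hthr : g.L ^ 2 ≤ Real.exp (1 / 8 * δ₂ * (g.R * g.M)))
    (h263 : Ineq263With c g (3 / 4 * δ₂) (1 / 3))
    {D₃ Gl : Module.End ℝ (X → ℝ)} {hI : X → ℝ} {S : Set g.Site}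
    (hD : HasMajorant blk D₃ fun y y'' => CD * Real.exp (-(cD * g.M)) / g.len y ^ 2 * Real.exp (-(δ₂ * g.dist y y'')))
    (hG : LocalMajorant blk Gl S fun y'' y' => CG * g.len y'' ^ 2 * Real.exp (-(δ₂ * g.dist y'' y')))
    (hGout : OutLoc blk Gl S) (hI1 : ∀ x, |hI x| ≤ 1) (hIS : ∀ x, hI x ≠ 0 → blk x ∈ S) :
    HasMajorant blk (D₃ * (Gl * mulOp hI)) fun y y' =>
      CD * Real.exp (-(cD * g.M)) * CG * g.L ^ 2 * c ^ 2 * Real.exp (-(1 / 2 * δ₂ * g.dist y y')) := by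
  classical
  have hL0 : 0 < g.L := zero_lt_one.trans_le hL
  have hlen : ∀ z : g.Site, 0 < g.len z := fun z => mul_pos (pow_pos hL0 _) hη
  have hCP : 0 ≤ CD * Real.exp (-(cD * g.M)) := mul_nonneg hCD (Real.exp_nonneg _)
  have hKG : ∀ a b : g.Site, 0 ≤ CG * g.len a ^ 2 * Real.exp (-(δ₂ * g.dist a b)) := fun a b => by positivity
  have hGl := hasMajorant_of_local blk hKG hGout hIS hI1 hG
  have hGlnn : ∀ a b : g.Site, 0 ≤ ind S a * ind S b * (CG * g.len a ^ 2 * Real.exp (-(δ₂ * g.dist a b))) :=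
    fun a b => mul_nonneg (mul_nonneg (ind_nonneg _ _) (ind_nonneg _ _)) (hKG a b)
  have hmul := hasMajorant_mul blk hD hGl hGlnn
  refine hasMajorant_mono blk hmul fun y y' => ?_
  have hKP : ∀ y'' : g.Site, 0 ≤ CD * Real.exp (-(cD * g.M)) / g.len y ^ 2 * Real.exp (-(δ₂ * g.dist y y'')) :=
    fun y'' => by
      have := hlen y
      positivity
  have hterm : ∀ y'' : g.Site,
      CD * Real.exp (-(cD * g.M)) / g.len y ^ 2 * Real.exp (-(δ₂ * g.dist y y'')) *
        (ind S y'' * ind S y' * (CG * g.len y'' ^ 2 * Real.exp (-(δ₂ * g.dist y'' y')))) ≤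
      CD * Real.exp (-(cD * g.M)) * CG * g.L ^ 2 *
        (Real.exp (-(3 / 4 * δ₂ * g.dist y y'')) * Real.exp (-(3 / 4 * δ₂ * g.dist y'' y'))) := by
    intro y''
    have hii : ind S y'' * ind S y' ≤ 1 :=
      (mul_le_mul (ind_le_one _ _) (ind_le_one _ _) (ind_nonneg _ _) zero_le_one).trans_eq (one_mul 1)
    have hgap : (0 : ℝ) * g.M ≤ g.dist y y'' := by rw [zero_mul]; exact hd y y''
    have ht := term_le hL hη hsep hd hδ₂ hCP hCG hRM hthr y' hgap
    have e0 : Real.exp (-(1 / 8 * δ₂ * (0 * g.M))) = 1 := by simp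
    rw [e0, mul_one] at ht
    calc CD * Real.exp (-(cD * g.M)) / g.len y ^ 2 * Real.exp (-(δ₂ * g.dist y y'')) *
          (ind S y'' * ind S y' * (CG * g.len y'' ^ 2 * Real.exp (-(δ₂ * g.dist y'' y'))))
        = ind S y'' * ind S y' * (CD * Real.exp (-(cD * g.M)) / g.len y ^ 2 * Real.exp (-(δ₂ * g.dist y y'')) *
            (CG * g.len y'' ^ 2 * Real.exp (-(δ₂ * g.dist y'' y')))) := by ring
      _ ≤ 1 * (CD * Real.exp (-(cD * g.M)) / g.len y ^ 2 * Real.exp (-(δ₂ * g.dist y y'')) *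
            (CG * g.len y'' ^ 2 * Real.exp (-(δ₂ * g.dist y'' y')))) :=
          mul_le_mul_of_nonneg_right hii (mul_nonneg (hKP y'') (hKG y'' y'))
      _ ≤ _ := by rw [one_mul]; exact ht
  have hKnn : 0 ≤ CD * Real.exp (-(cD * g.M)) * CG * g.L ^ 2 := by positivity
  calc ∑ y'' : g.Site, CD * Real.exp (-(cD * g.M)) / g.len y ^ 2 * Real.exp (-(δ₂ * g.dist y y'')) *
          (ind S y'' * ind S y' * (CG * g.len y'' ^ 2 * Real.exp (-(δ₂ * g.dist y'' y'))))
      ≤ ∑ y'' : g.Site, CD * Real.exp (-(cD * g.M)) * CG * g.L ^ 2 *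
          (Real.exp (-(3 / 4 * δ₂ * g.dist y y'')) * Real.exp (-(3 / 4 * δ₂ * g.dist y'' y'))) :=
        Finset.sum_le_sum fun y'' _ => hterm y''
    _ = CD * Real.exp (-(cD * g.M)) * CG * g.L ^ 2 *
          ∑ y'' : g.Site, Real.exp (-(3 / 4 * δ₂ * g.dist y y'')) * Real.exp (-(3 / 4 * δ₂ * g.dist y'' y')) := by
        rw [Finset.mul_sum]
    _ ≤ CD * Real.exp (-(cD * g.M)) * CG * g.L ^ 2 * (c ^ 2 * Real.exp (-(1 / 2 * δ₂ * g.dist y y'))) :=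
        mul_le_mul_of_nonneg_left (sum_le h263 y y') hKnn
    _ = _ := by ring

end DomLine

/-! ## §6 (2.134) for the diagonal pairs □ = □′: the four lines together, the explicit O(M⁻¹), the consumer's shape -/

section Diagonal

/-- **(2.134), DIAGONAL PAIRS □ = □′, KERNEL-CHECKED**: the operator `K_{□,□}G_□h_□` with `K_{□,□}` = line 1 (first-order
form `Σ_i c_iE_i − c₀`) + lines 2, 4 (the kernel commutators `Σ_k z_k(N_kh_□ − h_□N_k)`) + line 3 (the change of domain `D₃`)
of (2.92), under the displayed inputs of §3–§5, has the block majorant `θ_diag·e^{−½δ₂d(y,y′)}`,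
`θ_diag = (#D·s₁C₁ + s₂CG)/M + #K·(s/M)·CN·CG·L²·(8/δ₂ + r₀)·c² + CD·e^{−cD·M}·CG·L²·c²` (= O(M⁻¹), `theta_diag_le`).
[cite: Balaban1984PropagatorsII, (2.134) p.247 + (2.92) p.239] -/
theorem diag_hasMajorant (blk : X → g.Site) (hL : 1 ≤ g.L) (hη : 0 < g.eta) (hsep : LevelSep g)
    (hd : ∀ a b, 0 ≤ g.dist a b) {δ₂ CG C₁ CN CD cD c s s₁ s₂ r₀ : ℝ} (hδ₂ : 0 < δ₂) (hCG : 0 ≤ CG)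
    (hC₁ : 0 ≤ C₁) (hCN : 0 ≤ CN) (hCD : 0 ≤ CD) (hs : 0 ≤ s) (hs₁ : 0 ≤ s₁) (hs₂ : 0 ≤ s₂) (hr₀ : 0 ≤ r₀)
    (hM : 0 < g.M) (hRM : 0 ≤ g.R * g.M) (hthr : g.L ^ 2 ≤ Real.exp (1 / 8 * δ₂ * (g.R * g.M)))
    (h263 : Ineq263With c g (3 / 4 * δ₂) (1 / 3))
    {Gl D₃ : Module.End ℝ (X → ℝ)} {hI c₀ : X → ℝ} {S : Set g.Site}
    {ι : Type} (D : Finset ι) {E : ι → Module.End ℝ (X → ℝ)} {cf : ι → X → ℝ}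
    {κ : Type} (DK : Finset κ) {N : κ → Module.End ℝ (X → ℝ)} {z : κ → X → ℝ}
    (hG : LocalMajorant blk Gl S fun y y' => CG * g.len y ^ 2 * Real.exp (-(δ₂ * g.dist y y')))
    (hGout : OutLoc blk Gl S)
    (hEG : ∀ i ∈ D, LocalMajorant blk (E i * Gl) S fun y y' => C₁ * g.len y * Real.exp (-(δ₂ * g.dist y y')))
    (hc : ∀ i ∈ D, ∀ x, |cf i x| ≤ s₁ / (g.M * g.len (blk x))) (hcS : ∀ i ∈ D, ∀ x, cf i x ≠ 0 → blk x ∈ S)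
    (hc₀ : ∀ x, |c₀ x| ≤ s₂ / (g.M * g.len (blk x) ^ 2)) (hc₀S : ∀ x, c₀ x ≠ 0 → blk x ∈ S)
    (hI1 : ∀ x, |hI x| ≤ 1) (hIS : ∀ x, hI x ≠ 0 → blk x ∈ S)
    (hLip : ∀ x x', |hI x' - hI x| ≤ s / g.M * (g.dist (blk x) (blk x') + r₀))
    (hN : ∀ k ∈ DK, HasMajorant blk (N k) fun y y'' => CN / g.len y ^ 2 * Real.exp (-(δ₂ * g.dist y y'')))
    (hz : ∀ k ∈ DK, ∀ x, |z k x| ≤ 1)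
    (hD : HasMajorant blk D₃ fun y y'' => CD * Real.exp (-(cD * g.M)) / g.len y ^ 2 * Real.exp (-(δ₂ * g.dist y y''))) :
    HasMajorant blk
      (((∑ i ∈ D, mulOp (cf i) * E i - mulOp c₀) + (∑ k ∈ DK, mulOp (z k) * (N k * mulOp hI - mulOp hI * N k)) + D₃) *
        (Gl * mulOp hI))
      fun y y' =>
        ((D.card * (s₁ * C₁) + s₂ * CG) / g.M + DK.card * (s / g.M * (CN * CG * g.L ^ 2 * (8 / δ₂ + r₀)) * c ^ 2) +
            CD * Real.exp (-(cD * g.M)) * CG * g.L ^ 2 * c ^ 2) *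
          Real.exp (-(1 / 2 * δ₂ * g.dist y y')) := by
  classical
  have hL0 : 0 < g.L := zero_lt_one.trans_le hL
  rw [add_mul, add_mul, Finset.sum_mul]
  -- line 1
  have h1 := line1_hasMajorant blk hL0 hη hM (δ₂ := δ₂) hCG hC₁ hs₁ hs₂ D hG hEG hc hcS hc₀ hc₀S hI1 hIS
  -- lines 2, 4
  have h2 := hasMajorant_finsetSum blk DK (fun k => mulOp (z k) * (N k * mulOp hI - mulOp hI * N k) * (Gl * mulOp hI))
    (fun _ y y' => s / g.M * (CN * CG * g.L ^ 2 * (8 / δ₂ + r₀)) * c ^ 2 * Real.exp (-(1 / 2 * δ₂ * g.dist y y')))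
    fun k hk => commLine_hasMajorant blk hL hη hsep hd hδ₂ hCN hCG hs hr₀ hM hRM hthr h263 (hN k hk) (hz k hk) hLip hG
      hGout hI1 hIS
  -- line 3
  have h3 := domLine_hasMajorant blk hL hη hsep hd hδ₂.le hCD hCG hRM hthr h263 hD hG hGout hI1 hIS
  refine hasMajorant_mono blk (hasMajorant_add blk (hasMajorant_add blk h1 h2) h3) fun y y' => ?_
  -- pointwise: the rate δ₂ of line 1 is at least ½δ₂; the commutator lines add up
  have hθ₁ : 0 ≤ (D.card * (s₁ * C₁) + s₂ * CG) / g.M := by positivity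
  have hrate : Real.exp (-(δ₂ * g.dist y y')) ≤ Real.exp (-(1 / 2 * δ₂ * g.dist y y')) := by
    apply Real.exp_le_exp.mpr
    have := hd y y'
    nlinarith
  have hl1 : (D.card * (s₁ * C₁) + s₂ * CG) / g.M * Real.exp (-(δ₂ * g.dist y y')) ≤
      (D.card * (s₁ * C₁) + s₂ * CG) / g.M * Real.exp (-(1 / 2 * δ₂ * g.dist y y')) :=
    mul_le_mul_of_nonneg_left hrate hθ₁
  rw [Finset.sum_const, nsmul_eq_mul]
  nlinarith [hl1]

/-- **The printed O(M⁻¹)** of (2.134) for □ = □′: `θ_diag ≤ Θ·M⁻¹` with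
`Θ = #D·s₁C₁ + s₂CG + #K·s·CN·CG·L²·(8/δ₂ + r₀)·c² + CD·CG·L²·c²/cD` (using `e^{−cD·M} ≤ (cD·M)⁻¹`).
[cite: Balaban1984PropagatorsII, (2.134) p.247] -/
theorem theta_diag_le {δ₂ CG C₁ CN CD cD c s s₁ s₂ r₀ L M : ℝ} (nD nK : ℕ) (hM : 0 < M) (hcD : 0 < cD)
    (hCG : 0 ≤ CG) (hCD : 0 ≤ CD) :
    (nD * (s₁ * C₁) + s₂ * CG) / M + nK * (s / M * (CN * CG * L ^ 2 * (8 / δ₂ + r₀)) * c ^ 2) +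
        CD * Real.exp (-(cD * M)) * CG * L ^ 2 * c ^ 2 ≤
      (nD * (s₁ * C₁) + s₂ * CG + nK * (s * (CN * CG * L ^ 2 * (8 / δ₂ + r₀)) * c ^ 2) + CD * CG * L ^ 2 * c ^ 2 / cD) *
        M⁻¹ := by
  have h3 : CD * Real.exp (-(cD * M)) * CG * L ^ 2 * c ^ 2 ≤ CD * (cD * M)⁻¹ * CG * L ^ 2 * c ^ 2 := by
    have hexp := exp_le_inv_mul hcD hM
    have hrest : 0 ≤ CG * L ^ 2 * c ^ 2 := by positivity
    calc CD * Real.exp (-(cD * M)) * CG * L ^ 2 * c ^ 2 = CD * Real.exp (-(cD * M)) * (CG * L ^ 2 * c ^ 2) := by ring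
      _ ≤ CD * (cD * M)⁻¹ * (CG * L ^ 2 * c ^ 2) :=
          mul_le_mul_of_nonneg_right (mul_le_mul_of_nonneg_left hexp hCD) hrest
      _ = CD * (cD * M)⁻¹ * CG * L ^ 2 * c ^ 2 := by ring
  have hMne : M ≠ 0 := hM.ne'
  have hcne : cD ≠ 0 := hcD.ne'
  calc (nD * (s₁ * C₁) + s₂ * CG) / M + nK * (s / M * (CN * CG * L ^ 2 * (8 / δ₂ + r₀)) * c ^ 2) +
        CD * Real.exp (-(cD * M)) * CG * L ^ 2 * c ^ 2
      ≤ (nD * (s₁ * C₁) + s₂ * CG) / M + nK * (s / M * (CN * CG * L ^ 2 * (8 / δ₂ + r₀)) * c ^ 2) +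
        CD * (cD * M)⁻¹ * CG * L ^ 2 * c ^ 2 := by linarith [h3]
    _ = (nD * (s₁ * C₁) + s₂ * CG + nK * (s * (CN * CG * L ^ 2 * (8 / δ₂ + r₀)) * c ^ 2) +
          CD * CG * L ^ 2 * c ^ 2 / cD) * M⁻¹ := by
        field_simp

/-- **(2.134) for □ = □′ in the hypothesis shape of `B6Prop26Gluing.majorant_R_of_2134`** (`HasMajorant blk (Kt * mulOp h_□) K`
with `Kt = K_{□,□}·G_□`). Together with `B6Ineq2134OffDiag.offDiag_h2134` (□ ≠ □′) this is the whole hypothesis `h2134`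
of the consumer, each pair with its explicit O(M⁻¹). [cite: Balaban1984PropagatorsII, (2.134) p.247] -/
theorem diag_h2134 (blk : X → g.Site) (hL : 1 ≤ g.L) (hη : 0 < g.eta) (hsep : LevelSep g)
    (hd : ∀ a b, 0 ≤ g.dist a b) {δ₂ CG C₁ CN CD cD c s s₁ s₂ r₀ : ℝ} (hδ₂ : 0 < δ₂) (hCG : 0 ≤ CG)
    (hC₁ : 0 ≤ C₁) (hCN : 0 ≤ CN) (hCD : 0 ≤ CD) (hs : 0 ≤ s) (hs₁ : 0 ≤ s₁) (hs₂ : 0 ≤ s₂) (hr₀ : 0 ≤ r₀)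
    (hM : 0 < g.M) (hRM : 0 ≤ g.R * g.M) (hthr : g.L ^ 2 ≤ Real.exp (1 / 8 * δ₂ * (g.R * g.M)))
    (h263 : Ineq263With c g (3 / 4 * δ₂) (1 / 3))
    {Gl D₃ : Module.End ℝ (X → ℝ)} {hI c₀ : X → ℝ} {S : Set g.Site}
    {ι : Type} (D : Finset ι) {E : ι → Module.End ℝ (X → ℝ)} {cf : ι → X → ℝ}
    {κ : Type} (DK : Finset κ) {N : κ → Module.End ℝ (X → ℝ)} {z : κ → X → ℝ}
    (hG : LocalMajorant blk Gl S fun y y' => CG * g.len y ^ 2 * Real.exp (-(δ₂ * g.dist y y')))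
    (hGout : OutLoc blk Gl S)
    (hEG : ∀ i ∈ D, LocalMajorant blk (E i * Gl) S fun y y' => C₁ * g.len y * Real.exp (-(δ₂ * g.dist y y')))
    (hc : ∀ i ∈ D, ∀ x, |cf i x| ≤ s₁ / (g.M * g.len (blk x))) (hcS : ∀ i ∈ D, ∀ x, cf i x ≠ 0 → blk x ∈ S)
    (hc₀ : ∀ x, |c₀ x| ≤ s₂ / (g.M * g.len (blk x) ^ 2)) (hc₀S : ∀ x, c₀ x ≠ 0 → blk x ∈ S)
    (hI1 : ∀ x, |hI x| ≤ 1) (hIS : ∀ x, hI x ≠ 0 → blk x ∈ S)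
    (hLip : ∀ x x', |hI x' - hI x| ≤ s / g.M * (g.dist (blk x) (blk x') + r₀))
    (hN : ∀ k ∈ DK, HasMajorant blk (N k) fun y y'' => CN / g.len y ^ 2 * Real.exp (-(δ₂ * g.dist y y'')))
    (hz : ∀ k ∈ DK, ∀ x, |z k x| ≤ 1)
    (hD : HasMajorant blk D₃ fun y y'' => CD * Real.exp (-(cD * g.M)) / g.len y ^ 2 * Real.exp (-(δ₂ * g.dist y y''))) :
    HasMajorant blk
      (((∑ i ∈ D, mulOp (cf i) * E i - mulOp c₀) + (∑ k ∈ DK, mulOp (z k) * (N k * mulOp hI - mulOp hI * N k)) + D₃) *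
          Gl * mulOp hI)
      fun y y' =>
        ((D.card * (s₁ * C₁) + s₂ * CG) / g.M + DK.card * (s / g.M * (CN * CG * g.L ^ 2 * (8 / δ₂ + r₀)) * c ^ 2) +
            CD * Real.exp (-(cD * g.M)) * CG * g.L ^ 2 * c ^ 2) *
          Real.exp (-(1 / 2 * δ₂ * g.dist y y')) := by
  rw [mul_assoc]
  exact diag_hasMajorant blk hL hη hsep hd hδ₂ hCG hC₁ hCN hCD hs hs₁ hs₂ hr₀ hM hRM hthr h263 D DK hG hGout hEG hc hcS
    hc₀ hc₀S hI1 hIS hLip hN hz hD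

end Diagonal

end Literature.MathematicalPhysics.QuantumFieldTheory.Balaban1983to89.B6Ineq2134Diag
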